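import Literature.NumberTheory.EllipticCurves.BSDSelmerParityDokchitserBaseChangeProofs
import Literature.NumberTheory.EllipticCurves.CasselsTateParity
import Literature.NumberTheory.EllipticCurves.HeegnerPointsImaginaryQuadraticProofs
import Literature.Algebra.Module.AlternatingPairingParity
import HarnessLib

/-!
# Step (0) of the `p`-parity theorem over `ℚ` — the case `p = 2` — along Monsky's printed proof

Sibling proof file of `Literature.NumberTheory.EllipticCurves.BSDSelmerParityDokchitserProofs`,
which states the named fact `Literature.NumberTheory.EllipticCurves.monsky_selmerCorank_two_mod_two_eq`:
for every elliptic curve `E/ℚ`, `corank_{ℤ_2} Sel_{2^∞}(E/ℚ) ≡ ord_{s=1} L(E, s) (mod 2)` — step (0)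
of T. Dokchitser, V. Dokchitser, Ann. of Math. 172 (2010), proof of Thm. 4.19 (= Thm. 1.4): "For
`p = 2` this is due to Monsky [26]". This file formalises the ASSEMBLY of [26] = P. Monsky,
*Generalizing the Birch–Stephens theorem. I. Modular curves*, Math. Z. 221 (1996), 415–420
(read from the Göttingen scan of the printed paper), exactly along its printed lemma structure,
and proves the named fact from Monsky's two printed inputs that the tree does not have
(his Lemma 1.1 and Lemma 1.4(b), taken as explicit hypotheses `h11`, `h14` — no named fact is
introduced, D-0026) together with three inputs the tree does have: Gross–Zagier–Kolyvagin
(`rank_eq_analyticRank_of_analyticRank_le_one`, `LeadingTerm`), the Cassels–Tate pairing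
(`WeierstrassCurve.exists_casselsTate_pairing`, `BSDSha`) and the entire continuation of `L(E, s)`
(`WeierstrassCurve.hasEntireLFunction_rat`, i.e. modularity, `AnalyticRank`).

## Monsky's theorem and its proof (Math. Z. 221, pp. 415–417)

Notation of the paper (p. 415): for an elliptic curve `E` over a number field `k` and a prime `l`,
`s_l(E, k) = rank E(k) + dim_{ℤ/l} Ш_k(E)[l]` is "the `l`-Selmer rank"; for `E/ℚ` modular, `R(E)`
is the order of the zero of `L_E(s)` at `s = 1` ("analytic rank") and `W(E) = (−1)^{R(E)}` ("analytic
root number"). §1 (p. 416): a quadratic field `K` is "`E`-good" if `l` and all primes of bad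
reduction of `E` split in `K`; the twist `Ẽ` of `E` by such a `K` is a "good twist", real or
imaginary with `K`.

* **Lemma 1.1** (Waldspurger, *Correspondances de Shimura et quaternions*, Forum Math. 3 (1991),
  Thm. 4): "If `W(E) = 1` there is a good real twist, `Ẽ`, of `E` with `L_Ẽ(1) ≠ 0`. If
  `W(E) = −1` there is a good imaginary twist, `Ẽ`, of `E` with `L_Ẽ(1) ≠ 0`."
* **Lemma 1.2**: for `[L : F] = 2` and `Ẽ` the twist of `E/F` by `L`, `s_l(E, L) ≡ s_l(E, F) +
  s_l(Ẽ, F) (mod 2)` for every prime `l` (inflation–restriction; for `l = 2` the divisible parts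
  satisfy `a + ã = a_L`, and "since the Cassels pairing is non-degenerate on the quotient of the
  `2`-primary component of `Ш_F(E)` by `D`, `dim Ш_F(E)[2] ≡ a (mod 2)`").
* **Lemma 1.3**: in the situation of Lemma 1.1, `s_l(E, ℚ) ≡ s_l(E, K) (mod 2)` ("Since `L_Ẽ(1) ≠ 0`
  the combined labors of Gross–Zagier, Kolyvagin, and Murty–Murty (or Bump–Friedberg–Hoffstein)
  show that `Ẽ(ℚ)` and `Ш_ℚ(Ẽ)` are finite. Then the Cassels pairing is non-degenerate on
  `Ш_ℚ(Ẽ)`. So `Ш_ℚ(Ẽ)[l]` has even dimension and `s_l(Ẽ, ℚ)` is even. Now apply Lemma 1.2.").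
* **Lemma 1.4(b)** (p. 417; "immediate from results of Kramer", proved in §2 from Kramer,
  Trans. AMS 264 (1981), Thm. 1 and Prop. 3, Mazur 1972, and the product formula for the norm
  residue symbol): for a degree-`2` extension `L ⊃ F` of number fields and `E/F` such that all
  primes of `F` dividing `2` and all primes of bad reduction of `E` split in `L`, `s_2(E, L)` has the
  same parity as the number of real places of `F` that do not split in `L`.
* **Theorem 1.5**: "If `E` is modular over `ℚ`, `(−)^{s_2(E)} = W(E)`." Proof as printed: "Choose
  `Ẽ` and `K` as in Lemmas 1.1 and 1.3. If `W(E) = 1`, `K` is real quadratic. So Lemma 1.4 shows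
  that `s_l(E, K)` is even, and we apply Lemma 1.3. If `W(E) = −1`, `K` is imaginary quadratic,
  Lemma 1.4 shows that `s_l(E, K)` is odd, and Lemma 1.3 again gives the result."

All elliptic curves over `ℚ` being modular (Breuil–Conrad–Diamond–Taylor 2001), Thm. 1.5 says
`s_2(E) ≡ R(E) (mod 2)` for every `E/ℚ`.

## The vendored statement versus the printed one

The tree's fact concerns `rk_2(E/ℚ) = W.selmerCorank 2`, the `ℤ_2`-corank of `Sel_{2^∞}(E/ℚ)`,
which is `rank E(ℚ) + corank_{ℤ_2} Ш(E/ℚ)[2^∞]` (`selmerCorank_eq_mordellWeilRank_add_holds`,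
Greenberg 1999), i.e. the Dokchitsers' `rk_2`, whereas Monsky's `s_2(E) = rank E(ℚ) + dim Ш(E/ℚ)[2]`.
The two agree modulo `2` — this is exactly the Cassels-pairing sentence of Monsky's proof of
Lemma 1.2 quoted above (`dim Ш[2] ≡ a (mod 2)`, `a` the corank of the divisible part) — and in the
tree this congruence is a THEOREM granted the Cassels–Tate pairing: `CasselsTateParity` proves
`dim_{𝔽_p} Ш[p^∞]/p` even (`even_finrank_modN_primaryComponent_sha`), whence
`dim Ш[p] = corank Ш[p^∞] + 2m` (`exists_eq_shaCorank_add_two_mul_of_casselsTate` below) and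
`s_p(E, K) ≡ rk_p(E/K) (mod 2)` (`mordellWeilRank_add_mod_two_eq_selmerCorank_of_casselsTate`). So
the vendored statement is Monsky's Thm. 1.5 read through this congruence, which is how
Dokchitser–Dokchitser 2010 cite it; it is not mis-stated.

## What is proved here (no definitions, no named facts)

* `exists_natCard_shaTorsionBy_eq_pow`, `exists_eq_shaCorank_add_two_mul_of_casselsTate`,
  `mordellWeilRank_add_mod_two_eq_selmerCorank_of_casselsTate` — the passage `s_p ↔ rk_p` over any
  number field, from `exists_casselsTate_pairing` (Monsky p. 416; Cassels 1962);
* `selmerCorank_baseChange_eq_of_twist_entireLFunction_ne_zero` — **Lemma 1.3 in `rk`-form, PROVED**: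
  if the twist `Ẽ = E^{(d_K)}` by a quadratic field `K` has `L(Ẽ, 1) ≠ 0`, then
  `rk_p(E/K) = rk_p(E/ℚ)` for every prime `p`: Lemma 1.2 is the tree theorem
  `selmerCorank_baseChange_quadratic_holds` (`BSDSelmerParityDokchitserBaseChangeProofs`), and
  `rk_p(Ẽ) = 0` by Gross–Zagier–Kolyvagin (`selmerCorank_eq_analyticRank_of_analyticRank_le_one`,
  `L(Ẽ, 1) ≠ 0` meaning analytic rank `0` for the entire continuation);
* `monsky_selmerCorank_two_mod_two_eq_of_facts` — **Theorem 1.5, assembled as printed**, i.e. the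
  named fact `monsky_selmerCorank_two_mod_two_eq` from: `h11` = Lemma 1.1 and `h14` = Lemma 1.4(b)
  for `F = ℚ` (explicit hypotheses, transcribed below), Gross–Zagier–Kolyvagin, the Cassels–Tate
  pairing over quadratic fields, and the entire continuation;
  `monsky_selmerCorank_two_mod_two_eq_of_facts_of_exists_isNewformOf` — the same with the
  continuation replaced by the Modularity Theorem `exists_isNewformOf` (BCDT 2001, Thm. A);
* `monsky_lemma_1_1_of_rootNumber_form` — Lemma 1.1 with Monsky's analytic root number
  `W(E) = (−1)^{R(E)}` follows from the same statement written with the tree's sign of the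
  functional equation `WeierstrassCurve.rootNumber` (the form in which Waldspurger's theorem is
  vendored elsewhere, cf. `waldspurger_exists_heegnerField_twist_ne_zero`), given
  `W.even_analyticRank_iff`.

Transcription of the two hypotheses (`W` elliptic over `ℚ`, `K : Type` a number field):
"`K` quadratic" ↔ `Module.finrank ℚ K = 2`; "real" ↔ `NumberField.IsTotallyReal K`, "imaginary" ↔
`IsImaginaryQuadratic K`; "`2` splits in `K`" ↔ `SatisfiesHeegnerHypothesis 2 K` and "all primes of
bad reduction of `E` split in `K`" ↔ `SatisfiesHeegnerHypothesis (W.conductorNorm ℤ) K` (the primes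
of bad reduction of an elliptic `E/ℚ` are the prime divisors of its conductor `N_E`; the tree's
predicate says "exactly two primes above `p`" for every prime `p ∣ N`, `HeegnerPoints`); "the twist
of `E` by `K = ℚ(√d_K)`" ↔ `W.quadraticTwist (NumberField.discr K : ℚ)` (as in `NonvanishingTwists`
and `selmerCorank_baseChange_quadratic`); "`L_Ẽ(1) ≠ 0`" ↔ `Ẽ.entireLFunction 1 ≠ 0`;
"`W(E) = ±1`" ↔ `Even`/`Odd W.analyticRank` (Monsky's definition `W(E) = (−1)^{R(E)}`);
"`s_2(E, K)`" ↔ `(W.baseChange K).mordellWeilRank + u` where `#Ш(E/K)[2] = 2^u`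
(`u = dim_{ℤ/2} Ш_K(E)[2]`); "the number of real infinite places of `ℚ` that do not split in `K`"
↔ `NumberField.InfinitePlace.nrComplexPlaces K` (the unique real place of `ℚ` splits in a real
quadratic field, `r₂ = 0`, and lies under the unique complex place of an imaginary one, `r₂ = 1`).

`monsky_selmerCorank_two_mod_two_eq_holds` is NOT here: besides modularity, Kolyvagin and the
Cassels–Tate pairing (named facts of the tree, undischarged), it needs Lemma 1.1 (Waldspurger 1991,
Thm. 4) and Lemma 1.4(b) (Kramer 1981, Thm. 1 and Prop. 3), which are not in the tree; by D-0026 a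
proof file may not vendor them, so they enter as the hypotheses `h11`, `h14` of the assembly.

## References

* [Monsky1996] P. Monsky, *Generalizing the Birch–Stephens theorem. I. Modular curves*, Math. Z. 221
  (1996), 415–420: p. 415 (definitions of `s_l`, `R(E)`, `W(E)`), §1 p. 416 (Lemmas 1.1–1.3),
  p. 417 (Lemma 1.4, Theorem 1.5), §2 pp. 417–418 (Thms. 2.1–2.2, proof of Lemma 1.4(b)).
* [Kramer1981] K. Kramer, *Arithmetic of elliptic curves upon quadratic extension*, Trans. Amer.
  Math. Soc. 264 (1981), 121–135: Thm. 1, Prop. 3 (Monsky's [7]).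
* [Waldspurger1991] J.-L. Waldspurger, *Correspondances de Shimura et quaternions*, Forum Math. 3
  (1991), 219–307, Thm. 4 (Monsky's [11]).
* [Cassels1962ArithmeticIV] J. W. S. Cassels, J. reine angew. Math. 211 (1962), 95–112.
* [DokchitserDokchitserAnnals2010] T. Dokchitser, V. Dokchitser, Ann. of Math. 172 (2010),
  §4.6, proof of Thm. 4.19 (= Thm. 1.4): "For `p = 2` this is due to Monsky [26]".
* [Dokchitser2013ParityNotes] T. Dokchitser, *Notes on the parity conjecture* (2013) =
  arXiv:1009.5389, §2 (`rk_p = rk + δ_p`) and Remark 4.3/53 ("the same idea lies behind the proof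
  of the `p`-parity conjecture over `ℚ`, see [Mon] (`p = 2`)").
* [BCDTJAMS2001] C. Breuil, B. Conrad, F. Diamond, R. Taylor, J. Amer. Math. Soc. 14 (2001), Thm. A.
-/

noncomputable section

open scoped Classical
open scoped AddSubgroup

open WeierstrassCurve NumberField NumberField.InfinitePlace

universe u

namespace Literature.NumberTheory.EllipticCurves

/-! ### `s_p` versus `rk_p`: the Cassels pairing (Monsky 1996, p. 416) -/

section Cassels

variable {K : Type u} [Field K] [NumberField K]

/-- `#Ш(E/K)[p] = p^u` for some `u` (namely `u = dim_{𝔽_p} Ш(E/K)[p]`): `Ш(E/K)[p]` is a finite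
(`WeierstrassCurve.finite_sha_torsionBy_holds`, Silverman AEC X.4.2(b)) `𝔽_p`-vector space.
[folklore] -/
theorem exists_natCard_shaTorsionBy_eq_pow (V : WeierstrassCurve K) [V.IsElliptic] (p : ℕ)
    [hp : Fact p.Prime] : ∃ u : ℕ, Nat.card ((V.sha)[(p : ℤ)]) = p ^ u := by
  haveI : Finite ((V.sha)[(p : ℤ)]) :=
    V.finite_sha_torsionBy_holds (p : ℤ) (Int.natCast_ne_zero.mpr hp.out.ne_zero)
  letI : Module (ZMod p) ((V.sha)[(p : ℤ)]) := AddSubgroup.torsionBy.zmodModule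
  exact ⟨_, (pow_finrank_eq_natCard _).symm⟩

/-- **`dim_{𝔽_p} Ш(E/K)[p] ≡ corank_{ℤ_p} Ш(E/K)[p^∞] (mod 2)`, granted the Cassels–Tate pairing**
(Monsky 1996, p. 416, proof of Lemma 1.2: "Since the Cassels pairing is non-degenerate on the
quotient of the `2`-primary component of `Ш_F(E)` by `D`, `dim (Ш_F(E))_{(2)} ≡ a (2)`", `a` the
corank of the maximal divisible subgroup `D`; Cassels 1962). Precisely: if `#Ш(E/K)[p] = p^u` then
`u = W.shaCorank p + 2m` for some `m`. With `T = Ш[p^∞]`: `T[p] = Ш[p]` has `p^u` elements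
(`Literature.Algebra.Module.natCard_torsionBy_primaryComponent`), `shaCorank p = dim T[p] − dim T/pT`
(`Literature.NumberTheory.EllipticCurves.zpCorank`) with `dim T/pT ≤ dim T[p]`
(`finite_modN_of_primary`), and `dim T/pT = 2m` (`even_finrank_modN_primaryComponent_sha`,
`CasselsTateParity`, from `hCT`). [cite: Monsky1996, p. 416 (proof of Lemma 1.2)] [cite: Cassels1962ArithmeticIV] -/
theorem exists_eq_shaCorank_add_two_mul_of_casselsTate (hCT : exists_casselsTate_pairing (K := K))
    (V : WeierstrassCurve K) [V.IsElliptic] (p : ℕ) [hp : Fact p.Prime] {u : ℕ}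
    (hu : Nat.card ((V.sha)[(p : ℤ)]) = p ^ u) : ∃ m : ℕ, u = V.shaCorank p + 2 * m := by
  have hp0' : (p : ℤ) ≠ 0 := Int.natCast_ne_zero.mpr hp.out.ne_zero
  set T : AddSubgroup V.sha := AddCommGroup.primaryComponent V.sha p with hT
  haveI hShafin : Finite ((V.sha)[(p : ℤ)]) := V.finite_sha_torsionBy_holds (p : ℤ) hp0'
  have hcard : Nat.card (T[(p : ℤ)]) = Nat.card ((V.sha)[(p : ℤ)]) :=
    Literature.Algebra.Module.natCard_torsionBy_primaryComponent (A := V.sha) (p := p)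
  letI : Module (ZMod p) (T[(p : ℤ)]) := AddSubgroup.torsionBy.zmodModule
  haveI hTfin : Finite (T[(p : ℤ)]) :=
    Nat.finite_of_card_ne_zero (by rw [hcard, hu]; exact pow_ne_zero _ hp.out.ne_zero)
  have hfr : Module.finrank (ZMod p) (T[(p : ℤ)]) = u := by
    apply Nat.pow_right_injective hp.out.two_le
    simp only [pow_finrank_eq_natCard, hcard, hu]
  -- `T` is `p`-primary with finite `p`-torsion, so `T/pT` is finite with `#T/pT ≤ #T[p]`
  have hTprim : ∀ c : T, ∃ n : ℕ, p ^ n • c = 0 := fun c ↦ by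
    obtain ⟨n, hn⟩ := (AddCommGroup.mem_primaryComponent).mp c.2
    exact ⟨n, Subtype.ext (by rw [AddSubgroupClass.coe_nsmul, hn, ZeroMemClass.coe_zero])⟩
  obtain ⟨hfin, hle⟩ := finite_modN_of_primary (C := T) (p := p) hTprim
  haveI := hfin
  have hle' : Module.finrank (ZMod p) (ModN T p) ≤ u := by
    rw [← Nat.pow_le_pow_iff_right hp.out.one_lt, pow_finrank_eq_natCard, ← hu, ← hcard]
    exact hle
  -- Cassels–Tate: `dim T/pT` is even
  obtain ⟨m, hm⟩ := even_finrank_modN_primaryComponent_sha V p hCT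
  have hm' : Module.finrank (ZMod p) (ModN T p) = m + m := hm
  -- the corank formula
  have hcorank : V.shaCorank p =
      Module.finrank (ZMod p) (T[(p : ℤ)]) - Module.finrank (ZMod p) (ModN T p) := rfl
  have hsum : V.shaCorank p + Module.finrank (ZMod p) (ModN T p) = u := by
    rw [hcorank, hfr]
    exact Nat.sub_add_cancel hle'
  refine ⟨m, ?_⟩
  omega

/-- **`s_p(E, K) ≡ rk_p(E/K) (mod 2)`, granted the Cassels–Tate pairing.** Monsky's `p`-Selmer rank
`s_p(E, K) = rank E(K) + dim_{ℤ/p} Ш_K(E)[p]` (Math. Z. 221, p. 415; here `#Ш(E/K)[p] = p^u`) and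
the `ℤ_p`-corank `rk_p(E/K) = corank Sel_{p^∞}(E/K) = rank E(K) + corank Ш(E/K)[p^∞]`
(`selmerCorank_eq_mordellWeilRank_add_holds`, Greenberg 1999) have the same parity
(`exists_eq_shaCorank_add_two_mul_of_casselsTate`). [cite: Monsky1996, p. 415 (definition of `s_l`) and p. 416 (proof of Lemma 1.2)] -/
theorem mordellWeilRank_add_mod_two_eq_selmerCorank_of_casselsTate
    (hCT : exists_casselsTate_pairing (K := K)) (V : WeierstrassCurve K) [V.IsElliptic] (p : ℕ)
    [Fact p.Prime] {u : ℕ} (hu : Nat.card ((V.sha)[(p : ℤ)]) = p ^ u) :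
    (V.mordellWeilRank + u) % 2 = V.selmerCorank p % 2 := by
  obtain ⟨m, hm⟩ := exists_eq_shaCorank_add_two_mul_of_casselsTate hCT V p hu
  rw [V.selmerCorank_eq_mordellWeilRank_add_holds p, hm]
  omega

end Cassels

/-! ### Lemma 1.3 -/

/-- **Monsky's Lemma 1.3, in `rk`-form, PROVED.** Let `E/ℚ` be elliptic, `K` a quadratic field and
`Ẽ = E^{(d_K)}` the twist of `E` by `K`, and suppose `L(Ẽ, 1) ≠ 0`. Then for every prime `p`,
`rk_p(E/K) = rk_p(E/ℚ)` (Monsky, Math. Z. 221, Lemma 1.3: "`s_l(E, ℚ) ≡ s_l(E, K) (2)`"; his proof: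
"Since `L_Ẽ(1) ≠ 0` the combined labors of Gross–Zagier, Kolyvagin, and Murty–Murty (or
Bump–Friedberg–Hoffstein) show that `Ẽ(ℚ)` and `Ш_ℚ(Ẽ)` are finite [...] so `s_l(Ẽ, ℚ)` is even.
Now apply Lemma 1.2."). Here: `L(Ẽ, 1) ≠ 0` means analytic rank `0` for the entire continuation
(`hE`), so `rk_p(Ẽ/ℚ) = 0` by Gross–Zagier–Kolyvagin (`hGZK`,
`selmerCorank_eq_analyticRank_of_analyticRank_le_one`), and Lemma 1.2 is the tree theorem
`rk_p(E/K) = rk_p(E/ℚ) + rk_p(Ẽ/ℚ)` (`selmerCorank_baseChange_quadratic_holds`).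
[cite: Monsky1996, Lemma 1.3 (p. 416)] -/
theorem selmerCorank_baseChange_eq_of_twist_entireLFunction_ne_zero (hE : hasEntireLFunction_rat)
    (hGZK : rank_eq_analyticRank_of_analyticRank_le_one) (W : WeierstrassCurve ℚ) [W.IsElliptic]
    (K : Type) [Field K] [NumberField K] (hK : Module.finrank ℚ K = 2)
    (hL : (W.quadraticTwist (NumberField.discr K : ℚ)).entireLFunction 1 ≠ 0) (p : ℕ)
    [Fact p.Prime] : (W.baseChange K).selmerCorank p = W.selmerCorank p := by
  have hd : (NumberField.discr K : ℚ) ≠ 0 := by exact_mod_cast NumberField.discr_ne_zero K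
  haveI := W.isElliptic_quadraticTwist hd
  set W' := W.quadraticTwist (NumberField.discr K : ℚ) with hW'
  have hg : AnalyticAt ℂ W'.entireLFunction 1 :=
    (W'.differentiable_entireLFunction (hE W')).analyticAt 1
  have h0 : W'.analyticRank = 0 := by
    have h := hg.analyticOrderAt_eq_zero.mpr hL
    simp only [WeierstrassCurve.analyticRank, analyticOrderNatAt, h]
    rfl
  have htw := selmerCorank_eq_analyticRank_of_analyticRank_le_one hGZK W' p
    (h0.trans_le zero_le_one)
  rw [selmerCorank_baseChange_quadratic_holds W K hK p, htw, h0, add_zero]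

/-! ### Theorem 1.5, assembled as printed -/

/-- **Monsky's Theorem 1.5 ⟹ `monsky_selmerCorank_two_mod_two_eq`, assembled exactly as printed**
(Math. Z. 221, p. 417: "Choose `Ẽ` and `K` as in Lemmas 1.1 and 1.3. If `W(E) = 1`, `K` is real
quadratic. So Lemma 1.4 shows that `s_l(E, K)` is even, and we apply Lemma 1.3. If `W(E) = −1`, `K`
is imaginary quadratic, Lemma 1.4 shows that `s_l(E, K)` is odd, and Lemma 1.3 again gives the
result."). Inputs:

* `hE` — `L(E, s)` is entire for every elliptic `E/ℚ` (Monsky's standing hypothesis "`E` modular";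
  BCDT 2001), used to read "`L_Ẽ(1) ≠ 0`" as analytic rank `0`;
* `hGZK` — Gross–Zagier–Kolyvagin (Lemma 1.3);
* `hCT` — the Cassels–Tate pairing on `Ш` over (quadratic) number fields (Monsky p. 416), through
  which `s_2(E, K) ≡ rk_2(E/K) (mod 2)` (`mordellWeilRank_add_mod_two_eq_selmerCorank_of_casselsTate`);
* `h11` — **Lemma 1.1** (Waldspurger 1991, Thm. 4), transcribed: if `R(E)` is even (`W(E) = 1`)
  there is a real quadratic field `K` in which `2` and all primes dividing `N_E` split and whose
  twist `Ẽ = E^{(d_K)}` has `L(Ẽ, 1) ≠ 0`; if `R(E)` is odd (`W(E) = −1`) there is such an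
  imaginary quadratic field;
* `h14` — **Lemma 1.4(b) for `F = ℚ`** (Kramer 1981, Thm. 1 and Prop. 3, via Monsky's Thms.
  2.1–2.2), transcribed: for a quadratic field `K` in which `2` and all primes dividing `N_E` split,
  `s_2(E, K) = rank E(K) + dim Ш(E/K)[2]` has the parity of the number of real places of `ℚ` not
  split in `K`, i.e. of `r₂(K) = nrComplexPlaces K` (`0` for real, `1` for imaginary `K`).

Proof: with `K` from `h11`, `rk_2(E/K) = rk_2(E/ℚ)` (Lemma 1.3,
`selmerCorank_baseChange_eq_of_twist_entireLFunction_ne_zero`) and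
`rk_2(E/K) ≡ s_2(E, K) ≡ r₂(K) (mod 2)` (`hCT`, `h14`), while `r₂(K) ≡ R(E) (mod 2)` by the choice of
`K` (`IsTotallyReal.nrComplexPlaces_eq_zero`, `IsImaginaryQuadratic.nrComplexPlaces_eq_one`).
[cite: Monsky1996, Theorem 1.5 (p. 417), with Lemmas 1.1, 1.3, 1.4(b)] [cite: DokchitserDokchitserAnnals2010, §4.6, proof of Thm. 4.19 (case p = 2)] -/
theorem monsky_selmerCorank_two_mod_two_eq_of_facts (hE : hasEntireLFunction_rat)
    (hGZK : rank_eq_analyticRank_of_analyticRank_le_one)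
    (hCT : ∀ (K : Type) [Field K] [NumberField K], exists_casselsTate_pairing (K := K))
    (h11 : ∀ (W : WeierstrassCurve ℚ) [W.IsElliptic],
      (Even W.analyticRank → ∃ (K : Type) (_ : Field K) (_ : NumberField K),
        Module.finrank ℚ K = 2 ∧ IsTotallyReal K ∧ SatisfiesHeegnerHypothesis 2 K ∧
          SatisfiesHeegnerHypothesis (W.conductorNorm ℤ) K ∧
            (W.quadraticTwist (NumberField.discr K : ℚ)).entireLFunction 1 ≠ 0) ∧
      (Odd W.analyticRank → ∃ (K : Type) (_ : Field K) (_ : NumberField K),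
        IsImaginaryQuadratic K ∧ SatisfiesHeegnerHypothesis 2 K ∧
          SatisfiesHeegnerHypothesis (W.conductorNorm ℤ) K ∧
            (W.quadraticTwist (NumberField.discr K : ℚ)).entireLFunction 1 ≠ 0))
    (h14 : ∀ (W : WeierstrassCurve ℚ) [W.IsElliptic] (K : Type) [Field K] [NumberField K],
      Module.finrank ℚ K = 2 → SatisfiesHeegnerHypothesis 2 K →
        SatisfiesHeegnerHypothesis (W.conductorNorm ℤ) K →
          ∀ u : ℕ, Nat.card (((W.baseChange K).sha)[(2 : ℤ)]) = 2 ^ u →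
            ((W.baseChange K).mordellWeilRank + u) % 2 = nrComplexPlaces K % 2) :
    monsky_selmerCorank_two_mod_two_eq := by
  intro W _
  show W.selmerCorank 2 % 2 = W.analyticRank % 2
  rcases W.analyticRank.even_or_odd with he | ho
  · -- `W(E) = 1`: a good real twist
    obtain ⟨K, _, _, hK2, hKr, h2, hN, hL⟩ := (h11 W).1 he
    obtain ⟨u, hu⟩ := exists_natCard_shaTorsionBy_eq_pow (W.baseChange K) 2
    have h4 := h14 W K hK2 h2 hN u hu
    haveI := hKr
    rw [IsTotallyReal.nrComplexPlaces_eq_zero K] at h4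
    have hbr := mordellWeilRank_add_mod_two_eq_selmerCorank_of_casselsTate (hCT K)
      (W.baseChange K) 2 hu
    rw [selmerCorank_baseChange_eq_of_twist_entireLFunction_ne_zero hE hGZK W K hK2 hL 2] at hbr
    obtain ⟨r, hr⟩ := he
    omega
  · -- `W(E) = -1`: a good imaginary twist
    obtain ⟨K, _, _, hKi, h2, hN, hL⟩ := (h11 W).2 ho
    obtain ⟨u, hu⟩ := exists_natCard_shaTorsionBy_eq_pow (W.baseChange K) 2
    have h4 := h14 W K hKi.1 h2 hN u hu
    rw [hKi.nrComplexPlaces_eq_one] at h4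
    have hbr := mordellWeilRank_add_mod_two_eq_selmerCorank_of_casselsTate (hCT K)
      (W.baseChange K) 2 hu
    rw [selmerCorank_baseChange_eq_of_twist_entireLFunction_ne_zero hE hGZK W K hKi.1 hL 2] at hbr
    obtain ⟨r, hr⟩ := ho
    omega

/-- The same assembly with the entire continuation replaced by its source, the Modularity Theorem
`Literature.NumberTheory.EllipticCurves.ModularForms.exists_isNewformOf` (Monsky's hypothesis
"`E` modular over `ℚ`", now Breuil–Conrad–Diamond–Taylor 2001, Thm. A;
`WeierstrassCurve.hasEntireLFunction_rat_of_exists_isNewformOf`, `AnalyticRankModularityProofs`).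
[cite: Monsky1996, Theorem 1.5 (p. 417)] [cite: BCDTJAMS2001, Thm. A] -/
theorem monsky_selmerCorank_two_mod_two_eq_of_facts_of_exists_isNewformOf
    (hmod : Literature.NumberTheory.EllipticCurves.ModularForms.exists_isNewformOf)
    (hGZK : rank_eq_analyticRank_of_analyticRank_le_one)
    (hCT : ∀ (K : Type) [Field K] [NumberField K], exists_casselsTate_pairing (K := K))
    (h11 : ∀ (W : WeierstrassCurve ℚ) [W.IsElliptic],
      (Even W.analyticRank → ∃ (K : Type) (_ : Field K) (_ : NumberField K),
        Module.finrank ℚ K = 2 ∧ IsTotallyReal K ∧ SatisfiesHeegnerHypothesis 2 K ∧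
          SatisfiesHeegnerHypothesis (W.conductorNorm ℤ) K ∧
            (W.quadraticTwist (NumberField.discr K : ℚ)).entireLFunction 1 ≠ 0) ∧
      (Odd W.analyticRank → ∃ (K : Type) (_ : Field K) (_ : NumberField K),
        IsImaginaryQuadratic K ∧ SatisfiesHeegnerHypothesis 2 K ∧
          SatisfiesHeegnerHypothesis (W.conductorNorm ℤ) K ∧
            (W.quadraticTwist (NumberField.discr K : ℚ)).entireLFunction 1 ≠ 0))
    (h14 : ∀ (W : WeierstrassCurve ℚ) [W.IsElliptic] (K : Type) [Field K] [NumberField K],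
      Module.finrank ℚ K = 2 → SatisfiesHeegnerHypothesis 2 K →
        SatisfiesHeegnerHypothesis (W.conductorNorm ℤ) K →
          ∀ u : ℕ, Nat.card (((W.baseChange K).sha)[(2 : ℤ)]) = 2 ^ u →
            ((W.baseChange K).mordellWeilRank + u) % 2 = nrComplexPlaces K % 2) :
    monsky_selmerCorank_two_mod_two_eq :=
  monsky_selmerCorank_two_mod_two_eq_of_facts (hasEntireLFunction_rat_of_exists_isNewformOf hmod)
    hGZK hCT h11 h14

/-! ### Lemma 1.1 from its root-number form -/

/-- **Lemma 1.1 in Monsky's terms from its root-number form.** Monsky's `W(E)` is the *analytic*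
root number `(−1)^{R(E)}` (Math. Z. 221, p. 415), so his Lemma 1.1 is indexed by the parity of
`R(E) = W.analyticRank`; Waldspurger's theorem itself (Forum Math. 3 (1991), Thm. 4; the form
`waldspurger_exists_heegnerField_twist_ne_zero` of `NonvanishingTwists`) is indexed by the sign of
the functional equation, the tree's `WeierstrassCurve.rootNumber`. Given the parity consequence
of the functional equation `Even R(E) ↔ w(E) = 1` (`W.even_analyticRank_iff`; in the tree from
modularity, `even_analyticRank_iff_rootNumber_eq_one_of_exists_isNewformOf`), the root-number
form of Lemma 1.1 (`h`) gives the form used by `monsky_selmerCorank_two_mod_two_eq_of_facts`.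
[cite: Monsky1996, Lemma 1.1 (p. 416) and p. 415 (definition of `W(E)`)] [cite: Waldspurger1991, Thm. 4] -/
theorem monsky_lemma_1_1_of_rootNumber_form
    (hpar : ∀ (W : WeierstrassCurve ℚ) [W.IsElliptic], W.even_analyticRank_iff)
    (h : ∀ (W : WeierstrassCurve ℚ) [W.IsElliptic],
      (W.rootNumber = 1 → ∃ (K : Type) (_ : Field K) (_ : NumberField K),
        Module.finrank ℚ K = 2 ∧ IsTotallyReal K ∧ SatisfiesHeegnerHypothesis 2 K ∧
          SatisfiesHeegnerHypothesis (W.conductorNorm ℤ) K ∧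
            (W.quadraticTwist (NumberField.discr K : ℚ)).entireLFunction 1 ≠ 0) ∧
      (W.rootNumber = -1 → ∃ (K : Type) (_ : Field K) (_ : NumberField K),
        IsImaginaryQuadratic K ∧ SatisfiesHeegnerHypothesis 2 K ∧
          SatisfiesHeegnerHypothesis (W.conductorNorm ℤ) K ∧
            (W.quadraticTwist (NumberField.discr K : ℚ)).entireLFunction 1 ≠ 0))
    (W : WeierstrassCurve ℚ) [W.IsElliptic] :
    (Even W.analyticRank → ∃ (K : Type) (_ : Field K) (_ : NumberField K),
        Module.finrank ℚ K = 2 ∧ IsTotallyReal K ∧ SatisfiesHeegnerHypothesis 2 K ∧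
          SatisfiesHeegnerHypothesis (W.conductorNorm ℤ) K ∧
            (W.quadraticTwist (NumberField.discr K : ℚ)).entireLFunction 1 ≠ 0) ∧
      (Odd W.analyticRank → ∃ (K : Type) (_ : Field K) (_ : NumberField K),
        IsImaginaryQuadratic K ∧ SatisfiesHeegnerHypothesis 2 K ∧
          SatisfiesHeegnerHypothesis (W.conductorNorm ℤ) K ∧
            (W.quadraticTwist (NumberField.discr K : ℚ)).entireLFunction 1 ≠ 0) := by
  have hpar' : Even W.analyticRank ↔ W.rootNumber = 1 := hpar W
  refine ⟨fun he ↦ (h W).1 (hpar'.mp he), fun ho ↦ (h W).2 ?_⟩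
  rcases W.rootNumber_eq_one_or with h1 | h1
  · exact absurd (hpar'.mpr h1) (Nat.not_even_iff_odd.mpr ho)
  · exact h1

end Literature.NumberTheory.EllipticCurves

end
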